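/-
Copyright (c) 2026 the pub-hodgecm-mathlib formalisation cell (harness21).  Prover seat hodgecm-mathlib-K2E2-p12 (g6): Track B «K2-LIT», ENGINE E1,
h413 = stmt-HodgeConjecture-24833; line `K2_E1_TraceFormulaBeta`, 5Res campaign «ENDGAME BY FAMILIES», amendment #3 (266) G10 ∕ deal (268) of K2E1-plan (g7):
THE RANGE OF THE BLOCK PROJECTOR `P = P_χ ∘ R_f(e_{U₀})` IS EXACTLY THE SPACE OF `U₀`-INVARIANT `χ⁻¹`-EIGENVECTORS — the representation-theoretic half of `hEisdef_of_kType`.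
-/
import Summits.HodgeConjecture.HodgeConjecture.Theorems.K2E1BlockProjectorFixesVectorsU   -- ★ p860649 (this seat): `blockProjector_apply_eq_self` (the `←` direction), brings ★ p860372 `apply_comp_kType`, `kType_comm_restrict`
import Literature.NumberTheory.Automorphic.IntegratedOperatorFixedVectors                 -- ★ `apply_comp_integratedOperator_eq_self_of_forall_mul_eq`
import HarnessLib

/-!
# K2·E1 — `K2E1BlockProjectorRangeU`: `P x = x ↔ (∀ k ∈ U₀, π(ι_f k) x = x) ∧ (∀ k, π(ι_∞ κ k) x = χ(k⁻¹) • x)` FOR THE BLOCK PROJECTOR `P = P_χ ∘ R_f(e_{U₀})`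
# (the `P`-fixed vectors ARE the `(χ, U₀)`-vectors — the representation-theoretic half of `hEisdef_of_kType`, amendment #3 G10) [Knapp 1986 VIII §3; Borel–Jacquet §4.1]

Track B ∕ K2-LIT, crux h413 = `stmt-HodgeConjecture-24833`, route of record `HCCMUnconditional`; cell `hodgecm-mathlib`, squad K2, ENGINE E1 (5Res campaign, M2 v2, endgame bridge «D5′ ⇒ hatoms»:
K2E4-p23's `hEisdef : ∀ x ∈ cusp^⊥, P x = x → x ∈ Eis_τ` with `Eis_τ = cusp^⊥ ⊓ ((τ,U₀)-part)`).  THEOREMS ONLY (no `def`, no `instance`, no notation, no named-fact hypothesis, no `sorry`; default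
heartbeats); lane `--supports stmt-HodgeConjecture-24833 --as helper` (count-neutral).  CLOSES NO SOCKET.  Generic two-factor setting of ★ p860333∕p860372 (`ι₁ : G₁ →* G`, `ι₂ : G₂ →* G`
commuting; compact `κ : K →* G₁`, probability left-invariant `μ`, multiplicative `χ ∈ C_c(K)`; `e ∈ C_c(G₂)` vanishing off `U₀`, `∫ e = 1`, left-`U₀`-invariant; `η₂` left-invariant), then the
`cmDatum L N H` print.
* §1 `apply_comp_blockProjector_eq_of_mem` — `π(ι₂ k) ∘L P = P` for `k ∈ U₀` (`π(ι₂ k)` commutes with `P_χ`: ★ `kType_comm_restrict`; absorbed by `R₂ e`: ★ `apply_comp_integratedOperator_eq_self_of_forall_mul_eq`);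
  `apply_comp_blockProjector_eq_smul` — `π(ι₁ κ k) ∘L P = χ(k⁻¹) • P` (★ `apply_comp_kType`); hence **`level_invariant_of_blockProjector_eq_self`**, **`kType_eigen_of_blockProjector_eq_self`** and the
  characterisation **`blockProjector_eq_self_iff`** (`←` = ★ p860649 `blockProjector_apply_eq_self`).
* §2 E1 prints at ★ `cmDatum L N H`: **`cm_level_invariant_of_blockProjector_eq_self`**, **`cm_kType_eigen_of_blockProjector_eq_self`**, **`cm_blockProjector_eq_self_iff`** — K2E4-p23 composes with
  his `Eis_τ` bytes for `hEisdef_of_kType` (`x ∈ cusp^⊥ ∧ P x = x ⇒ x ∈ cusp^⊥ ⊓ (τ,U₀)-part`); τ enters only as `χ = conj τ` (every `N`, every `H`, every `K`-type given by a character).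
HONEST LABEL: HC_CM is proved only modulo the 7 printed citations (2 remaining named inputs: hLiu418 = `stmt-HodgeConjecture-24832`, h413 = `stmt-HodgeConjecture-24833`) until rung 0
closes; this file asserts no named fact and closes no socket; count-neutral; unconditional.

## References
* [Knapp1986] A. W. Knapp, *Representation Theory of Semisimple Groups* (1986): VIII §3 (`E_τ` is the projection ONTO the `τ`-isotypic subspace).
* [BorelJacquet1979] A. Borel, H. Jacquet, PSPM 33.1 (1979): §4.1 (`π(e_{K′}) V = V^{K′}`).
* [DeitmarEchterhoff2014] A. Deitmar, S. Echterhoff, *Principles of Harmonic Analysis* (2014): Lemma 1.6.3, §7.4.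
-/

set_option autoImplicit false
set_option linter.dupNamespace false -- the mandated namespace repeats `HodgeConjecture.HodgeConjecture`

noncomputable section

open MeasureTheory Filter Topology CompactlySupported NumberField
open Literature.NumberTheory.Automorphic Literature.NumberTheory.Automorphic.UnitaryGroup AdelicGroupData
open Summit.HodgeConjecture.HodgeConjecture.Cruxes.H413.K2E1KTypeProjectorPureTensorU (apply_comp_kType kType_comm_restrict)
open Summit.HodgeConjecture.HodgeConjecture.Cruxes.H413.K2E1PureTensorHeckeAlgebraU (cm_hcomm)
open Summit.HodgeConjecture.HodgeConjecture.Cruxes.H413.K2E1BlockProjectorFixesVectorsU (blockProjector_apply_eq_self)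

namespace Summit.HodgeConjecture.HodgeConjecture.Cruxes.H413.K2E1BlockProjectorRangeU

/-! ## §1 Generic two-factor setting -/

section TwoFactor

variable {G G₁ G₂ K V : Type*} [Group G] [TopologicalSpace G] [Group G₁] [TopologicalSpace G₁]
  [Group G₂] [TopologicalSpace G₂] [MeasurableSpace G₂] [BorelSpace G₂]
  [Group K] [TopologicalSpace K] [MeasurableSpace K] [BorelSpace K]
  [NormedAddCommGroup V] [InnerProductSpace ℂ V] [CompleteSpace V]
  (π : ContRepresentation ℂ G V) (hu : π.IsUnitary) (hc : π.IsStronglyContinuous)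
  (ι₁ : G₁ →* G) (hι₁ : Continuous ι₁) (ι₂ : G₂ →* G) (hι₂ : Continuous ι₂) (κ : K →* G₁) (hκ : Continuous κ)
  (η₂ : Measure G₂) [IsFiniteMeasureOnCompacts η₂] (μ : Measure K) [IsFiniteMeasureOnCompacts μ] (χ : C_c(K, ℂ))

/-- **`π(ι₂ k) ∘ P = P` FOR `k ∈ U₀`**: `π(ι₂ k)` commutes with `P_χ` (the images of `ι₁`, `ι₂` commute) and is absorbed by `R₂ e` (`e` left-`U₀`-invariant, `η₂` left-invariant).
[cite: BorelJacquet1979, §4.1] [cite: DeitmarEchterhoff2014, Lemma 1.6.3] -/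
theorem apply_comp_blockProjector_eq_of_mem [MeasurableMul G₂] [η₂.IsMulLeftInvariant] (hcomm : ∀ (x : G₁) (y : G₂), ι₁ x * ι₂ y = ι₂ y * ι₁ x)
    (U₀ : Subgroup G₂) (e : C_c(G₂, ℂ)) (heK : ∀ k ∈ U₀, ∀ x, e (k * x) = e x) {k : G₂} (hk : k ∈ U₀) :
    π (ι₂ k) ∘L ((π.restrict (ι₁.comp κ)).integratedOperator (hu.restrict (ι₁.comp κ)) (hc.restrict (ι₁.comp κ) (hι₁.comp hκ)) μ χ ∘L
        (π.restrict ι₂).integratedOperator (hu.restrict ι₂) (hc.restrict ι₂ hι₂) η₂ e) =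
      (π.restrict (ι₁.comp κ)).integratedOperator (hu.restrict (ι₁.comp κ)) (hc.restrict (ι₁.comp κ) (hι₁.comp hκ)) μ χ ∘L
        (π.restrict ι₂).integratedOperator (hu.restrict ι₂) (hc.restrict ι₂ hι₂) η₂ e := by
  have habs := ContRepresentation.apply_comp_integratedOperator_eq_self_of_forall_mul_eq (hu.restrict ι₂) (hc.restrict ι₂ hι₂) η₂ U₀ e heK hk
  rw [ContRepresentation.restrict_apply] at habs
  rw [← ContinuousLinearMap.comp_assoc, ← kType_comm_restrict π hu hc ι₁ hι₁ ι₂ κ hκ μ χ hcomm k, ContinuousLinearMap.comp_assoc, habs]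

omit [MeasurableSpace G₂] [BorelSpace G₂] [IsFiniteMeasureOnCompacts η₂] in
/-- **`π(ι₁ κ k) ∘ P = χ(k⁻¹) • P`** (★ `apply_comp_kType` on the first factor). [cite: Knapp1986, VIII §3] -/
theorem apply_comp_blockProjector_eq_smul [MeasurableMul K] [μ.IsMulLeftInvariant] (hχmul : ∀ k l, χ (k * l) = χ k * χ l) (Q : V →L[ℂ] V) (k : K) :
    π (ι₁ (κ k)) ∘L ((π.restrict (ι₁.comp κ)).integratedOperator (hu.restrict (ι₁.comp κ)) (hc.restrict (ι₁.comp κ) (hι₁.comp hκ)) μ χ ∘L Q) =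
      χ k⁻¹ • ((π.restrict (ι₁.comp κ)).integratedOperator (hu.restrict (ι₁.comp κ)) (hc.restrict (ι₁.comp κ) (hι₁.comp hκ)) μ χ ∘L Q) := by
  rw [← ContinuousLinearMap.comp_assoc, apply_comp_kType π hu hc ι₁ hι₁ κ hκ μ χ hχmul k, ContinuousLinearMap.smul_comp]

/-- **A `P`-FIXED VECTOR IS `U₀`-INVARIANT**: `P x = x → π(ι₂ k) x = x` for `k ∈ U₀`. [cite: BorelJacquet1979, §4.1] -/
theorem level_invariant_of_blockProjector_eq_self [MeasurableMul G₂] [η₂.IsMulLeftInvariant] (hcomm : ∀ (x : G₁) (y : G₂), ι₁ x * ι₂ y = ι₂ y * ι₁ x)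
    (U₀ : Subgroup G₂) (e : C_c(G₂, ℂ)) (heK : ∀ k ∈ U₀, ∀ x, e (k * x) = e x) (x : V)
    (hx : ((π.restrict (ι₁.comp κ)).integratedOperator (hu.restrict (ι₁.comp κ)) (hc.restrict (ι₁.comp κ) (hι₁.comp hκ)) μ χ ∘L
        (π.restrict ι₂).integratedOperator (hu.restrict ι₂) (hc.restrict ι₂ hι₂) η₂ e) x = x) {k : G₂} (hk : k ∈ U₀) :
    π (ι₂ k) x = x := by
  conv_lhs => rw [← hx]
  rw [← ContinuousLinearMap.comp_apply, apply_comp_blockProjector_eq_of_mem π hu hc ι₁ hι₁ ι₂ hι₂ κ hκ η₂ μ χ hcomm U₀ e heK hk, hx]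

omit [MeasurableSpace G₂] [BorelSpace G₂] [IsFiniteMeasureOnCompacts η₂] in
/-- **A `P`-FIXED VECTOR IS A `χ⁻¹`-EIGENVECTOR OF `K`**: `P x = x → π(ι₁ κ k) x = χ(k⁻¹) • x` (E1, `χ = conj τ`: `x` is `τ`-isotypic). [cite: Knapp1986, VIII §3] -/
theorem kType_eigen_of_blockProjector_eq_self [MeasurableMul K] [μ.IsMulLeftInvariant] (hχmul : ∀ k l, χ (k * l) = χ k * χ l) (Q : V →L[ℂ] V) (x : V)
    (hx : ((π.restrict (ι₁.comp κ)).integratedOperator (hu.restrict (ι₁.comp κ)) (hc.restrict (ι₁.comp κ) (hι₁.comp hκ)) μ χ ∘L Q) x = x) (k : K) :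
    π (ι₁ (κ k)) x = χ k⁻¹ • x := by
  conv_lhs => rw [← hx]
  rw [← ContinuousLinearMap.comp_apply, apply_comp_blockProjector_eq_smul π hu hc ι₁ hι₁ κ hκ μ χ hχmul Q k, FunLike.coe_smul, Pi.smul_apply, hx]

/-- **THE RANGE OF THE BLOCK PROJECTOR**: `P x = x ↔ (∀ k ∈ U₀, π(ι₂ k) x = x) ∧ (∀ k, π(ι₁ κ k) x = χ(k⁻¹) • x)` (`→` above; `←` ★ p860649 `blockProjector_apply_eq_self`).
[cite: Knapp1986, VIII §3] [cite: BorelJacquet1979, §4.1] -/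
theorem blockProjector_eq_self_iff [MeasurableMul G₂] [η₂.IsMulLeftInvariant] [MeasurableMul K] [μ.IsMulLeftInvariant] [IsProbabilityMeasure μ]
    (hcomm : ∀ (x : G₁) (y : G₂), ι₁ x * ι₂ y = ι₂ y * ι₁ x) (hχmul : ∀ k l, χ (k * l) = χ k * χ l) (hχone : χ 1 = 1)
    (U₀ : Subgroup G₂) (e : C_c(G₂, ℂ)) (he0 : ∀ g, g ∉ U₀ → e g = 0) (he1 : ∫ g, e g ∂η₂ = 1) (heK : ∀ k ∈ U₀, ∀ x, e (k * x) = e x) (x : V) :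
    ((π.restrict (ι₁.comp κ)).integratedOperator (hu.restrict (ι₁.comp κ)) (hc.restrict (ι₁.comp κ) (hι₁.comp hκ)) μ χ ∘L
        (π.restrict ι₂).integratedOperator (hu.restrict ι₂) (hc.restrict ι₂ hι₂) η₂ e) x = x ↔
      (∀ k ∈ U₀, π (ι₂ k) x = x) ∧ (∀ k : K, π (ι₁ (κ k)) x = χ k⁻¹ • x) :=
  ⟨fun hx => ⟨fun _ hk => level_invariant_of_blockProjector_eq_self π hu hc ι₁ hι₁ ι₂ hι₂ κ hκ η₂ μ χ hcomm U₀ e heK x hx hk,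
      kType_eigen_of_blockProjector_eq_self π hu hc ι₁ hι₁ κ hκ μ χ hχmul _ x hx⟩,
    fun h => blockProjector_apply_eq_self π hu hc ι₁ hι₁ ι₂ hι₂ κ hκ η₂ μ χ hχmul hχone U₀ e he0 he1 x h.1 h.2⟩

end TwoFactor

/-! ## §2 The E1 prints at ★ `cmDatum L N H` -/

section CM

variable {L : Type} [Field L] [NumberField L] [IsCMField L] {N : ℕ} {H : Matrix (Fin N) (Fin N) L}
  {K V : Type*} [Group K] [TopologicalSpace K] [MeasurableSpace K] [BorelSpace K]
  [NormedAddCommGroup V] [InnerProductSpace ℂ V] [CompleteSpace V]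
  (π : ContRepresentation ℂ (cmDatum L N H).Adelic V) (hu : π.IsUnitary) (hc : π.IsStronglyContinuous)
  [MeasurableSpace (finAdelic (↥(maximalRealSubfield L)) L (IsCMField.complexConj L) N H)] [BorelSpace (finAdelic (↥(maximalRealSubfield L)) L (IsCMField.complexConj L) N H)]
  (νf : Measure (finAdelic (↥(maximalRealSubfield L)) L (IsCMField.complexConj L) N H)) [IsFiniteMeasureOnCompacts νf] [νf.IsMulLeftInvariant]
  (κ : K →* UnitaryGroup.arch (↥(maximalRealSubfield L)) L (IsCMField.complexConj L) N H) (hκ : Continuous κ)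
  (μ : Measure K) [IsFiniteMeasureOnCompacts μ] [MeasurableMul K] [μ.IsMulLeftInvariant] (χ : C_c(K, ℂ))
  (e : C_c(finAdelic (↥(maximalRealSubfield L)) L (IsCMField.complexConj L) N H, ℂ))

omit [MeasurableMul K] [μ.IsMulLeftInvariant] in
/-- **A `P`-FIXED VECTOR IS `U₀`-INVARIANT** at `U(H)(𝔸_{L⁺})` (the `invariants` half of `hEisdef`). [cite: BorelJacquet1979, §4.1] -/
theorem cm_level_invariant_of_blockProjector_eq_self
    (U₀ : Subgroup (finAdelic (↥(maximalRealSubfield L)) L (IsCMField.complexConj L) N H)) (heK : ∀ k ∈ U₀, ∀ x, e (k * x) = e x) (x : V)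
    (hx : ((π.restrict ((archToAdelic (↥(maximalRealSubfield L)) L (IsCMField.complexConj L) N H).comp κ)).integratedOperator (hu.restrict _)
          (hc.restrict _ ((continuous_archToAdelic (↥(maximalRealSubfield L)) L (IsCMField.complexConj L) N H).comp hκ)) μ χ ∘L
        (π.restrict (finAdelicToAdelic (↥(maximalRealSubfield L)) L (IsCMField.complexConj L) N H)).integratedOperator (hu.restrict _)
          (hc.restrict _ (continuous_finAdelicToAdelic (↥(maximalRealSubfield L)) L (IsCMField.complexConj L) N H)) νf e) x = x)
    {k : finAdelic (↥(maximalRealSubfield L)) L (IsCMField.complexConj L) N H} (hk : k ∈ U₀) :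
    π (finAdelicToAdelic (↥(maximalRealSubfield L)) L (IsCMField.complexConj L) N H k) x = x :=
  level_invariant_of_blockProjector_eq_self π hu hc _ (continuous_archToAdelic (↥(maximalRealSubfield L)) L (IsCMField.complexConj L) N H)
    _ (continuous_finAdelicToAdelic (↥(maximalRealSubfield L)) L (IsCMField.complexConj L) N H) κ hκ νf μ χ cm_hcomm U₀ e heK x hx hk

omit [MeasurableSpace (finAdelic (↥(maximalRealSubfield L)) L (IsCMField.complexConj L) N H)] [BorelSpace (finAdelic (↥(maximalRealSubfield L)) L (IsCMField.complexConj L) N H)]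
  [IsFiniteMeasureOnCompacts νf] [νf.IsMulLeftInvariant] in
/-- **A `P`-FIXED VECTOR IS A `χ⁻¹`-EIGENVECTOR OF `κ(K) ≤ U(H)(L⁺ ⊗ ℝ)`** (`χ = conj τ`: `τ`-isotypic). [cite: Knapp1986, VIII §3] -/
theorem cm_kType_eigen_of_blockProjector_eq_self (hχmul : ∀ k l, χ (k * l) = χ k * χ l) (Q : V →L[ℂ] V) (x : V)
    (hx : ((π.restrict ((archToAdelic (↥(maximalRealSubfield L)) L (IsCMField.complexConj L) N H).comp κ)).integratedOperator (hu.restrict _)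
          (hc.restrict _ ((continuous_archToAdelic (↥(maximalRealSubfield L)) L (IsCMField.complexConj L) N H).comp hκ)) μ χ ∘L Q) x = x) (k : K) :
    π (archToAdelic (↥(maximalRealSubfield L)) L (IsCMField.complexConj L) N H (κ k)) x = χ k⁻¹ • x :=
  kType_eigen_of_blockProjector_eq_self π hu hc _ (continuous_archToAdelic (↥(maximalRealSubfield L)) L (IsCMField.complexConj L) N H) κ hκ μ χ hχmul Q x hx k

/-- **THE RANGE OF THE BLOCK PROJECTOR AT `U(H)(𝔸_{L⁺})`**: `P x = x ↔ (U₀-invariant) ∧ (χ⁻¹-eigen under κ(K))` — with K2E4-p23's `Eis_τ` bytes this is `hEisdef_of_kType` on `cusp^⊥`.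
[cite: Knapp1986, VIII §3] [cite: BorelJacquet1979, §4.1] -/
theorem cm_blockProjector_eq_self_iff [IsProbabilityMeasure μ] (hχmul : ∀ k l, χ (k * l) = χ k * χ l) (hχone : χ 1 = 1)
    (U₀ : Subgroup (finAdelic (↥(maximalRealSubfield L)) L (IsCMField.complexConj L) N H)) (he0 : ∀ g, g ∉ U₀ → e g = 0) (he1 : ∫ g, e g ∂νf = 1)
    (heK : ∀ k ∈ U₀, ∀ x, e (k * x) = e x) (x : V) :
    ((π.restrict ((archToAdelic (↥(maximalRealSubfield L)) L (IsCMField.complexConj L) N H).comp κ)).integratedOperator (hu.restrict _)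
          (hc.restrict _ ((continuous_archToAdelic (↥(maximalRealSubfield L)) L (IsCMField.complexConj L) N H).comp hκ)) μ χ ∘L
        (π.restrict (finAdelicToAdelic (↥(maximalRealSubfield L)) L (IsCMField.complexConj L) N H)).integratedOperator (hu.restrict _)
          (hc.restrict _ (continuous_finAdelicToAdelic (↥(maximalRealSubfield L)) L (IsCMField.complexConj L) N H)) νf e) x = x ↔
      (∀ k ∈ U₀, π (finAdelicToAdelic (↥(maximalRealSubfield L)) L (IsCMField.complexConj L) N H k) x = x) ∧
        (∀ k : K, π (archToAdelic (↥(maximalRealSubfield L)) L (IsCMField.complexConj L) N H (κ k)) x = χ k⁻¹ • x) :=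
  blockProjector_eq_self_iff π hu hc _ (continuous_archToAdelic (↥(maximalRealSubfield L)) L (IsCMField.complexConj L) N H)
    _ (continuous_finAdelicToAdelic (↥(maximalRealSubfield L)) L (IsCMField.complexConj L) N H) κ hκ νf μ χ cm_hcomm hχmul hχone U₀ e he0 he1 heK x

end CM

end Summit.HodgeConjecture.HodgeConjecture.Cruxes.H413.K2E1BlockProjectorRangeU

end
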